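import Summits.QuantumFields.YangMills.Theorems.AllWindowsColdBoxJaffardDecayTools

/-!
# Discrete convolution of power kernels on index sets of polynomial growth (for the (J′4) assembly of STUB-PLAN-U1 rev 3 §7.4 and K1-E)

Stated ONCE for an arbitrary pseudo-distance `d` on a finite index type (the skin links, the bulk links, the neutral-current strata …):
* `sum_mul_le_two_region` — the two-region split behind every such count: if `|f z|(1+d x z)^a ≤ A` and `|g z|(1+d z y)^b ≤ B` then
  `Σ_z |f z||g z| ≤ 2^a A (1+d x y)^{−a} Σ_z|g z| + 2^b B (1+d x y)^{−b} Σ_z|f z|` (no growth hypothesis; the matrix form is `Jaffard.decay_mul_le`);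
* `sum_inv_rpow_le_of_growth` — the row sum `S_r(y) = Σ_z (1+d z y)^{−r} ≤ c_S 2^D (1 − 2^{D−r})⁻¹` for `r > D` (`tail_sum_le_of_growth` at `ρ = 0`);
* `sum_inv_rpow_crit_le_of_growth` — the CRITICAL row sum `Σ_z (1+d z y)^{−D} ≤ c_S 2^D (⌊log₂(1+R)⌋₊ + 1)` when `d(·,y) ≤ R` (dyadic shells: each shell
  carries `≤ c_S 2^D`, and there are `≤ ⌊log₂(1+R)⌋₊ + 1` of them) — the `(1 + log H)` of the skin counts;
* `sum_kernel_mul_kernel_le` — the packaged two-kernel estimate `Σ_z (1+d x z)^{−a}(1+d z y)^{−b} ≤ (2^a S_b + 2^b S_a)(1+d x y)^{−min}` in the form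
  `… ≤ 2^a (1+d x y)^{−a} S_b(y) + 2^b (1+d x y)^{−b} S_a(x)`.
Mathlib-only; no definitions; standard axioms.

HONEST LABEL: helper lemmas toward the OPEN stubs S3b/U1 (⟨stmt-QuantumFields-24004⟩, ⟨24336⟩) and K1 (⟨24006⟩); no stub, crux, rung or summit is proved
here; the Yang–Mills mass gap is NOT proved by this file.
-/

set_option autoImplicit false

open Finset

namespace Summit.QuantumFields.YangMills.Theorems.AllWindowsColdBox.Jaffard

variable {ι : Type*} [Fintype ι]

/-- **Two-region split.**  If `|f z| (1+d x z)^a ≤ A` and `|g z| (1+d z y)^b ≤ B` for all `z` (pseudo-distance `d`: nonnegative, triangle inequality), then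
`Σ_z |f z| |g z| ≤ 2^a A ((1+d x y)^a)⁻¹ Σ_z |g z| + 2^b B ((1+d x y)^b)⁻¹ Σ_z |f z|`: on `{d x y ≤ 2 d x z}` the first kernel pays the distance, elsewhere
`d x y ≤ 2 d z y` and the second one does. -/
theorem sum_mul_le_two_region (d : ι → ι → ℝ) {a b : ℝ} (ha : 0 ≤ a) (hb : 0 ≤ b) (hd0 : ∀ x y, 0 ≤ d x y)
    (htri : ∀ x y z, d x y ≤ d x z + d z y) (x y : ι) {f g : ι → ℝ} {A B : ℝ} (hA : 0 ≤ A) (hB : 0 ≤ B)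
    (hf : ∀ z, |f z| * (1 + d x z) ^ a ≤ A) (hg : ∀ z, |g z| * (1 + d z y) ^ b ≤ B) :
    ∑ z, |f z| * |g z| ≤ 2 ^ a * A * ((1 + d x y) ^ a)⁻¹ * ∑ z, |g z| + 2 ^ b * B * ((1 + d x y) ^ b)⁻¹ * ∑ z, |f z| := by
  have hwa : 0 < (1 + d x y) ^ a := Real.rpow_pos_of_pos (by linarith [hd0 x y]) a
  have hwb : 0 < (1 + d x y) ^ b := Real.rpow_pos_of_pos (by linarith [hd0 x y]) b
  set S : Finset ι := Finset.univ.filter (fun z => d x y ≤ 2 * d x z) with hS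
  -- on `S`: `|f z| ≤ 2^a A (1+d x y)^{-a}`
  have key1 : ∀ z ∈ S, |f z| ≤ 2 ^ a * A * ((1 + d x y) ^ a)⁻¹ := by
    intro z hz
    have hz' : d x y ≤ 2 * d x z := (Finset.mem_filter.1 hz).2
    have h1 : (1 + d x y) ^ a ≤ (2 * (1 + d x z)) ^ a := Real.rpow_le_rpow (by linarith [hd0 x y]) (by linarith) ha
    rw [Real.mul_rpow (by norm_num) (by linarith [hd0 x z])] at h1
    have hwz : 0 < (1 + d x z) ^ a := Real.rpow_pos_of_pos (by linarith [hd0 x z]) a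
    rw [← div_eq_mul_inv, le_div_iff₀ hwa]
    calc |f z| * (1 + d x y) ^ a ≤ |f z| * (2 ^ a * (1 + d x z) ^ a) := mul_le_mul_of_nonneg_left h1 (abs_nonneg _)
      _ = 2 ^ a * (|f z| * (1 + d x z) ^ a) := by ring
      _ ≤ 2 ^ a * A := mul_le_mul_of_nonneg_left (hf z) (Real.rpow_nonneg (by norm_num) a)
  -- off `S`: `|g z| ≤ 2^b B (1+d x y)^{-b}`
  have key2 : ∀ z ∈ Finset.univ.filter (fun z => ¬ d x y ≤ 2 * d x z), |g z| ≤ 2 ^ b * B * ((1 + d x y) ^ b)⁻¹ := by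
    intro z hz
    have hz' : ¬ d x y ≤ 2 * d x z := (Finset.mem_filter.1 hz).2
    have hz'' : d x y ≤ 2 * d z y := by have := htri x y z; have := not_le.1 hz'; linarith
    have h1 : (1 + d x y) ^ b ≤ (2 * (1 + d z y)) ^ b := Real.rpow_le_rpow (by linarith [hd0 x y]) (by linarith) hb
    rw [Real.mul_rpow (by norm_num) (by linarith [hd0 z y])] at h1
    rw [← div_eq_mul_inv, le_div_iff₀ hwb]
    calc |g z| * (1 + d x y) ^ b ≤ |g z| * (2 ^ b * (1 + d z y) ^ b) := mul_le_mul_of_nonneg_left h1 (abs_nonneg _)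
      _ = 2 ^ b * (|g z| * (1 + d z y) ^ b) := by ring
      _ ≤ 2 ^ b * B := mul_le_mul_of_nonneg_left (hg z) (Real.rpow_nonneg (by norm_num) b)
  have hc1 : 0 ≤ 2 ^ a * A * ((1 + d x y) ^ a)⁻¹ := by positivity
  have hc2 : 0 ≤ 2 ^ b * B * ((1 + d x y) ^ b)⁻¹ := by positivity
  rw [← Finset.sum_filter_add_sum_filter_not Finset.univ (fun z => d x y ≤ 2 * d x z)]
  have h1 : ∑ z ∈ S, |f z| * |g z| ≤ 2 ^ a * A * ((1 + d x y) ^ a)⁻¹ * ∑ z, |g z| := by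
    calc ∑ z ∈ S, |f z| * |g z| ≤ ∑ z ∈ S, 2 ^ a * A * ((1 + d x y) ^ a)⁻¹ * |g z| :=
          Finset.sum_le_sum fun z hz => mul_le_mul_of_nonneg_right (key1 z hz) (abs_nonneg _)
      _ = 2 ^ a * A * ((1 + d x y) ^ a)⁻¹ * ∑ z ∈ S, |g z| := by rw [Finset.mul_sum]
      _ ≤ 2 ^ a * A * ((1 + d x y) ^ a)⁻¹ * ∑ z, |g z| :=
          mul_le_mul_of_nonneg_left (Finset.sum_le_sum_of_subset_of_nonneg (Finset.subset_univ _) fun z _ _ => abs_nonneg _) hc1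
  have h2 : ∑ z ∈ Finset.univ.filter (fun z => ¬ d x y ≤ 2 * d x z), |f z| * |g z| ≤
      2 ^ b * B * ((1 + d x y) ^ b)⁻¹ * ∑ z, |f z| := by
    calc ∑ z ∈ Finset.univ.filter (fun z => ¬ d x y ≤ 2 * d x z), |f z| * |g z|
          ≤ ∑ z ∈ Finset.univ.filter (fun z => ¬ d x y ≤ 2 * d x z), |f z| * (2 ^ b * B * ((1 + d x y) ^ b)⁻¹) :=
          Finset.sum_le_sum fun z hz => mul_le_mul_of_nonneg_left (key2 z hz) (abs_nonneg _)
      _ = 2 ^ b * B * ((1 + d x y) ^ b)⁻¹ * ∑ z ∈ Finset.univ.filter (fun z => ¬ d x y ≤ 2 * d x z), |f z| := by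
          rw [Finset.mul_sum]; exact Finset.sum_congr rfl fun z _ => by ring
      _ ≤ 2 ^ b * B * ((1 + d x y) ^ b)⁻¹ * ∑ z, |f z| :=
          mul_le_mul_of_nonneg_left (Finset.sum_le_sum_of_subset_of_nonneg (Finset.subset_univ _) fun z _ _ => abs_nonneg _) hc2
  exact add_le_add h1 h2

/-- **Two power kernels**: `Σ_z (1+d x z)^{−a} (1+d z y)^{−b} ≤ 2^a (1+d x y)^{−a} S_b(y) + 2^b (1+d x y)^{−b} S_a(x)` with the row sums
`S_a(x) = Σ_z (1+d x z)^{−a}`, `S_b(y) = Σ_z (1+d z y)^{−b}`. -/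
theorem sum_kernel_mul_kernel_le (d : ι → ι → ℝ) {a b : ℝ} (ha : 0 ≤ a) (hb : 0 ≤ b) (hd0 : ∀ x y, 0 ≤ d x y)
    (htri : ∀ x y z, d x y ≤ d x z + d z y) (x y : ι) :
    ∑ z, ((1 + d x z) ^ a)⁻¹ * ((1 + d z y) ^ b)⁻¹ ≤
      2 ^ a * ((1 + d x y) ^ a)⁻¹ * ∑ z, ((1 + d z y) ^ b)⁻¹ + 2 ^ b * ((1 + d x y) ^ b)⁻¹ * ∑ z, ((1 + d x z) ^ a)⁻¹ := by
  have hposa : ∀ u v, 0 < (1 + d u v) ^ a := fun u v => Real.rpow_pos_of_pos (by linarith [hd0 u v]) a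
  have hposb : ∀ u v, 0 < (1 + d u v) ^ b := fun u v => Real.rpow_pos_of_pos (by linarith [hd0 u v]) b
  have h := sum_mul_le_two_region d ha hb hd0 htri x y (f := fun z => ((1 + d x z) ^ a)⁻¹) (g := fun z => ((1 + d z y) ^ b)⁻¹)
    zero_le_one zero_le_one
    (fun z => by rw [abs_of_pos (inv_pos.2 (hposa x z)), inv_mul_cancel₀ (hposa x z).ne'])
    (fun z => by rw [abs_of_pos (inv_pos.2 (hposb z y)), inv_mul_cancel₀ (hposb z y).ne'])
  have e1 : ∀ z, |((1 + d x z) ^ a)⁻¹| = ((1 + d x z) ^ a)⁻¹ := fun z => abs_of_pos (inv_pos.2 (hposa x z))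
  have e2 : ∀ z, |((1 + d z y) ^ b)⁻¹| = ((1 + d z y) ^ b)⁻¹ := fun z => abs_of_pos (inv_pos.2 (hposb z y))
  simp only [e1, e2, mul_one] at h
  exact h

/-- **Row sums above the critical exponent**: with volume growth `#{z : d z y ≤ ρ} ≤ c_S (1+ρ)^D` and `0 ≤ D < r`,
`Σ_z (1+d z y)^{−r} ≤ c_S 2^D (1 − 2^{D−r})⁻¹`. -/
theorem sum_inv_rpow_le_of_growth (d : ι → ι → ℝ) {r D cS : ℝ} (hD : 0 ≤ D) (hDr : D < r) (hcS : 0 ≤ cS)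
    (hd0 : ∀ x y, 0 ≤ d x y)
    (hG1 : ∀ (y : ι) (ρ : ℝ), 0 ≤ ρ → ((Finset.univ.filter (fun z => d z y ≤ ρ)).card : ℝ) ≤ cS * (1 + ρ) ^ D) (y : ι) :
    ∑ z, ((1 + d z y) ^ r)⁻¹ ≤ cS * (2 : ℝ) ^ D * (1 - (2 : ℝ) ^ (D - r))⁻¹ := by
  have h := tail_sum_le_of_growth d hD hDr hcS hG1 y 0 le_rfl
  rw [Finset.filter_true_of_mem (fun z _ => hd0 z y)] at h
  simpa using h

/-- **Row sums AT the critical exponent** (`r = D`): if moreover `d z y ≤ R` for all `z`, then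
`Σ_z (1+d z y)^{−D} ≤ c_S 2^D (⌊log₂(1+R)⌋₊ + 1)` — the dyadic shell `2^i ≤ 1 + d < 2^{i+1}` carries at most `c_S 2^{(i+1)D}·2^{−iD} = c_S 2^D`, and
`i ≤ log₂(1+R)`. -/
theorem sum_inv_rpow_crit_le_of_growth (d : ι → ι → ℝ) {D cS R : ℝ} (hD : 0 ≤ D)
    (hd0 : ∀ x y, 0 ≤ d x y)
    (hG1 : ∀ (y : ι) (ρ : ℝ), 0 ≤ ρ → ((Finset.univ.filter (fun z => d z y ≤ ρ)).card : ℝ) ≤ cS * (1 + ρ) ^ D) (y : ι)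
    (hdR : ∀ z, d z y ≤ R) :
    ∑ z, ((1 + d z y) ^ D)⁻¹ ≤ cS * (2 : ℝ) ^ D * ((⌊Real.logb 2 (1 + R)⌋₊ : ℝ) + 1) := by
  classical
  -- dyadic index
  set idx : ι → ℕ := fun z => ⌊Real.logb 2 (1 + d z y)⌋₊ with hidx
  have hT1 : ∀ z, 1 ≤ 1 + d z y := fun z => by linarith [hd0 z y]
  have hlow : ∀ z, (2 : ℝ) ^ (idx z : ℝ) ≤ 1 + d z y := by
    intro z
    have hT0 : 0 < 1 + d z y := by linarith [hd0 z y]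
    have h1 : ((idx z : ℕ) : ℝ) ≤ Real.logb 2 (1 + d z y) := Nat.floor_le (Real.logb_nonneg one_lt_two (hT1 z))
    have h2 : (2 : ℝ) ^ (idx z : ℝ) ≤ (2 : ℝ) ^ Real.logb 2 (1 + d z y) := Real.rpow_le_rpow_of_exponent_le one_le_two h1
    rwa [Real.rpow_logb two_pos (by norm_num) hT0] at h2
  have hupp : ∀ z, 1 + d z y < (2 : ℝ) ^ ((idx z : ℝ) + 1) := by
    intro z
    have hT0 : 0 < 1 + d z y := by linarith [hd0 z y]
    have h1 : Real.logb 2 (1 + d z y) < (idx z : ℝ) + 1 := Nat.lt_floor_add_one _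
    have h2 : (2 : ℝ) ^ Real.logb 2 (1 + d z y) < (2 : ℝ) ^ ((idx z : ℝ) + 1) := Real.rpow_lt_rpow_of_exponent_lt one_lt_two h1
    rwa [Real.rpow_logb two_pos (by norm_num) hT0] at h2
  -- the range of the index
  have hidxle : ∀ z, idx z ≤ ⌊Real.logb 2 (1 + R)⌋₊ := fun z =>
    Nat.floor_le_floor (Real.logb_le_logb_of_le one_lt_two (by linarith [hd0 z y]) (by linarith [hdR z]))
  -- one shell
  have hshell : ∀ i : ℕ, ∑ z ∈ Finset.univ.filter (fun z => idx z = i), ((1 + d z y) ^ D)⁻¹ ≤ cS * (2 : ℝ) ^ D := by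
    intro i
    have h2i : 0 < (2 : ℝ) ^ (i : ℝ) := Real.rpow_pos_of_pos two_pos _
    have hterm : ∀ z ∈ Finset.univ.filter (fun z => idx z = i), ((1 + d z y) ^ D)⁻¹ ≤ (((2 : ℝ) ^ (i : ℝ)) ^ D)⁻¹ := by
      intro z hz
      have hzi : idx z = i := (Finset.mem_filter.1 hz).2
      have h1 : (2 : ℝ) ^ (i : ℝ) ≤ 1 + d z y := by rw [← hzi]; exact hlow z
      exact inv_anti₀ (Real.rpow_pos_of_pos h2i D) (Real.rpow_le_rpow h2i.le h1 hD)
    have hcount : ((Finset.univ.filter (fun z => idx z = i)).card : ℝ) ≤ cS * ((2 : ℝ) ^ ((i : ℝ) + 1)) ^ D := by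
      have hsub : Finset.univ.filter (fun z => idx z = i) ⊆ Finset.univ.filter (fun z => d z y ≤ (2 : ℝ) ^ ((i : ℝ) + 1) - 1) := by
        intro z hz
        have hzi : idx z = i := (Finset.mem_filter.1 hz).2
        have h1 : 1 + d z y < (2 : ℝ) ^ ((i : ℝ) + 1) := by rw [← hzi]; exact hupp z
        exact Finset.mem_filter.2 ⟨Finset.mem_univ _, by linarith⟩
      have hρ' : 0 ≤ (2 : ℝ) ^ ((i : ℝ) + 1) - 1 := by
        have : (1 : ℝ) ≤ (2 : ℝ) ^ ((i : ℝ) + 1) := Real.one_le_rpow one_le_two (by positivity)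
        linarith
      calc ((Finset.univ.filter (fun z => idx z = i)).card : ℝ)
            ≤ ((Finset.univ.filter (fun z => d z y ≤ (2 : ℝ) ^ ((i : ℝ) + 1) - 1)).card : ℝ) := by exact_mod_cast Finset.card_le_card hsub
        _ ≤ cS * (1 + ((2 : ℝ) ^ ((i : ℝ) + 1) - 1)) ^ D := hG1 y _ hρ'
        _ = cS * ((2 : ℝ) ^ ((i : ℝ) + 1)) ^ D := by rw [add_sub_cancel]
    have halg : ((2 : ℝ) ^ ((i : ℝ) + 1)) ^ D * (((2 : ℝ) ^ (i : ℝ)) ^ D)⁻¹ = (2 : ℝ) ^ D := by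
      have h2 : (0 : ℝ) < 2 := two_pos
      rw [← Real.rpow_mul h2.le, ← Real.rpow_mul h2.le, ← Real.rpow_neg h2.le, ← Real.rpow_add h2]
      congr 1; ring
    calc ∑ z ∈ Finset.univ.filter (fun z => idx z = i), ((1 + d z y) ^ D)⁻¹
          ≤ ∑ z ∈ Finset.univ.filter (fun z => idx z = i), (((2 : ℝ) ^ (i : ℝ)) ^ D)⁻¹ := Finset.sum_le_sum hterm
      _ = ((Finset.univ.filter (fun z => idx z = i)).card : ℝ) * (((2 : ℝ) ^ (i : ℝ)) ^ D)⁻¹ := by rw [Finset.sum_const, nsmul_eq_mul]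
      _ ≤ cS * ((2 : ℝ) ^ ((i : ℝ) + 1)) ^ D * (((2 : ℝ) ^ (i : ℝ)) ^ D)⁻¹ :=
          mul_le_mul_of_nonneg_right hcount (inv_nonneg.2 (Real.rpow_nonneg h2i.le _))
      _ = cS * (2 : ℝ) ^ D := by rw [mul_assoc, halg]
  -- sum over the shells `0 … ⌊log₂(1+R)⌋₊`
  set N : ℕ := ⌊Real.logb 2 (1 + R)⌋₊ with hN
  have hfib := Finset.sum_fiberwise_of_maps_to (s := (Finset.univ : Finset ι)) (t := Finset.range (N + 1)) (g := idx)
    (fun z _ => Finset.mem_range.2 (Nat.lt_succ_of_le (hidxle z))) (fun z => ((1 + d z y) ^ D)⁻¹)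
  rw [← hfib]
  calc ∑ i ∈ Finset.range (N + 1), ∑ z ∈ Finset.univ.filter (fun z => idx z = i), ((1 + d z y) ^ D)⁻¹
        ≤ ∑ i ∈ Finset.range (N + 1), cS * (2 : ℝ) ^ D := Finset.sum_le_sum fun i _ => hshell i
    _ = cS * (2 : ℝ) ^ D * ((N : ℝ) + 1) := by
        rw [Finset.sum_const, Finset.card_range, nsmul_eq_mul]; push_cast; ring

end Summit.QuantumFields.YangMills.Theorems.AllWindowsColdBox.Jaffard
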